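import Mathlib
import Literature.Combinatorics.Optimization.SheraliAdamsRandomRestriction
import HarnessLib

/-!
# `d` rounds of Sherali–Adams are an LP relaxation of size `n^{O(d)}`
# (Chan–Lee–Raghavendra–Steurer 2013/2016, §2.1) — PROVED

Source: [ChanEtAl2016] arXiv:1309.0563v3 §2.1 (held `paper:arxiv-1309.0563`, p. 8): "A `d`-round
Sherali–Adams LP relaxation for a `Π_n` instance will consist of variables `{X_S : S ⊆ [n], |S| ≤ d}`
for all products of up to degree `d` on the `n` variables. … The `d`-round Sherali–Adams value of a
`Π_n` instance `ℑ` is defined as `SA_d(ℑ) = max_{d-ℓ.e.f. Ẽ} Ẽ ℑ`.  This optimization problem can be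
implemented by an `n^{O(d)}`-sized linear programming relaxation for `Π_n`. (Notice that `Ẽ` is only
an `n^d`-dimensional object.)  In particular, if `d`-rounds of Sherali–Adams achieve a
`(c,s)`-approximation for `Π_n`, then so do general `n^{O(d)}`-sized LP relaxations."

This is the converse direction of the tree's `ChanEtAl2016_thm31_holds` (LP relaxations of size
`≤ n^{d/2}` are no stronger than `SA_d`): together they say that polynomial-size LP relaxations and
constant-round Sherali–Adams are equivalent in power up to polynomial factors in the size.  It also
furnishes an explicit INHABITANT of the model `LPRelaxation k n 𝒫 R` (`LPRelaxationsMaxCSP.lean`, KMR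
Def. 1.1 = the [ChanEtAl2016] §2 model), i.e. a non-vacuity witness for that structure (bounded
polytope containing every `v_x`, exact linearization of every instance) built from scratch — the
tree's only other construction, `LPRelaxation.restrict`, derives one relaxation from another.

## The LP (moment coordinates) and the proof

Vocabulary: `LPRelaxation`, `SAPseudoexpectation n d`, `SAAchieves`, the generators
`SADuality.gen (S, β) = 𝟙[x|_S = β|_S]` of the cone of nonnegative `d`-juntas and `SADuality.junta_decomp`
(Lemma 2.4(i)) from `LPRelaxationsMaxCSP.lean`; characters `walsh`, coefficients `cubeFourierCoeff`,
`fourierTruncate` and `fourierTruncate_eq_self_of_hasDegreeLE`, `SAPseudoexpectation.abs_E_walsh_le_one`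
(Lemma 2.4(ii)) from `SheraliAdamsRandomRestriction.lean` / `PseudoDensityFourier.lean`.

* Linearization (dimension `D = #{S ⊆ [n] : |S| ≤ d} = Σ_{i ≤ d} C(n,i) ≤ 1 + n^d`):
  `v_x = (χ_S(x))_{|S| ≤ d}`, `w_ℑ = (ℑ̂(S))_{|S| ≤ d}`; exactness `ℑ(x) = ⟨w_ℑ, v_x⟩` is Fourier
  inversion, `ℑ` having degree `≤ k ≤ d` (`CSPInstance.hasDegreeLE_val`; the guard `k ≤ d` is the one
  under which `SA_d(ℑ)` is defined in print).
* Polytope (size `R = D² + 2 ≤ (1 + n^d)² + 2 = n^{O(d)}`): for every pair `(S, T)` of sets of size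
  `≤ d` the inequality `Ẽ_y 𝟙[x|_S = 𝟙_T|_S] ≥ 0`, where `Ẽ_y f = Σ_{|S| ≤ d} f̂(S) y_S` is the moment
  functional of `y ∈ ℝ^D`, and the two inequalities `y_∅ ≤ 1`, `−y_∅ ≤ −1`.  (The printed LP (2.3)
  has one row per generator `(S, β)`; only `β|_S` matters, and every pattern vanishing off `S` is
  `𝟙_T` with `T = supp β ⊆ S`, `|T| ≤ d` — so indexing rows by pairs `(S,T)` lists every generator,
  some repeatedly, at size `D²` instead of `2^d · D`; both are `n^{O(d)}`.)
* `v_x` is feasible (`Ẽ_{v_x} f = f_{≤ d}(x)`, and a generator is its own truncation, `≥ 0`); a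
  feasible `y` IS a degree-`d` pseudoexpectation (`SALp.toPE`: nonnegativity on all nonnegative
  `d`-juntas from the generator rows via `junta_decomp`, `Ẽ_y 1 = y_∅ = 1`), so `|y_S| = |Ẽ_y χ_S| ≤ 1`
  (Lemma 2.4(ii)) — the polytope is BOUNDED — and `⟨w_ℑ, y⟩ = Ẽ_y ℑ ≤ c` whenever `SA_d` achieves
  `(c,s)` and `opt(ℑ) ≤ s`.

Contents (all PROVED; 0 named facts): `SALp.Idx`, `SALp.momE` (moment functional), `SALp.momV`,
`SALp.momA`/`momB`/`Feasible`, `SALp.toPE`, `SALp.feasible_momV`, `SALp.dim`/`size` with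
`dim_eq`/`dim_le`/`size_eq`/`size_le`, `SALp.relaxation : LPRelaxation k n 𝒫 (size n d)`,
`SALp.ofPE`/`feasible_ofPE` (conversely every pseudoexpectation is a feasible point: the feasible
region IS the set of degree-`d` moment vectors), `SALp.relaxation_valueLE_iff` (the LP value of `ℑ` is
`≤ c` iff `SA_d(ℑ) ≤ c`), `SALp.relaxation_achieves_iff`/`relaxation_achieves`, and the headlines
`ChanEtAl2016_sa_as_lp` (one LP of size `≤ (1 + n^d)² + 2` achieving `(c,s)` iff `SA_d` does, all
`c, s`) and `ChanEtAl2016_lp_of_saAchieves`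
(`SA_d` achieves `(c,s)` ⟹ an LP relaxation of size `≤ (1 + n^d)² + 2` achieves `(c,s)`), with the
contrapositive `ChanEtAl2016_not_saAchieves_of_lp` in the shape of `ChanEtAl2016_thm31`.
-/

noncomputable section

open Finset Matrix
open Literature.Probability.RandomGraphs.LowDegree (walsh walsh_empty)
open Literature.Computability.Complexity.LowDegree (cubeFourierCoeff sum_cubeFourierCoeff_mul_walsh
  sum_walsh_mul_walsh_index)

namespace Literature.Combinatorics.Optimization

namespace SALp

variable {n d : ℕ}

/-! ### Moment coordinates and the moment functional -/

/-- The index set of the Sherali–Adams moments: sets `S ⊆ [n]` with `|S| ≤ d` ("variables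
`{X_S : S ⊆ [n], |S| ≤ d}`"). [cite: ChanEtAl2016, §2.1 (arXiv v3 p. 8)] -/
abbrev Idx (n d : ℕ) : Type := {S : Finset (Fin n) // S.card ≤ d}

/-- The empty set as a moment index (the coordinate `X_∅ = Ẽ 1`). [cite: ChanEtAl2016, §2.1 (arXiv v3 p. 8)] -/
def idx0 (n d : ℕ) : Idx n d := ⟨∅, by simp⟩

/-- Linearity of the Fourier coefficients (sum). [folklore] -/
private theorem cfc_add (f g : (Fin n → Bool) → ℝ) (S : Finset (Fin n)) :
    cubeFourierCoeff (f + g) S = cubeFourierCoeff f S + cubeFourierCoeff g S := by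
  unfold Literature.Computability.Complexity.LowDegree.cubeFourierCoeff
  rw [← add_div, ← sum_add_distrib]
  congr 1
  refine sum_congr rfl fun x _ => ?_
  rw [Pi.add_apply, add_mul]

/-- Linearity of the Fourier coefficients (scalar). [folklore] -/
private theorem cfc_smul (a : ℝ) (f : (Fin n → Bool) → ℝ) (S : Finset (Fin n)) :
    cubeFourierCoeff (a • f) S = a * cubeFourierCoeff f S := by
  unfold Literature.Computability.Complexity.LowDegree.cubeFourierCoeff
  rw [mul_div_assoc', mul_sum]
  congr 1
  refine sum_congr rfl fun x _ => ?_
  rw [Pi.smul_apply, smul_eq_mul, mul_assoc]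

/-- The coefficients of a character: `χ̂_T(S) = [T = S]`. [folklore] -/
private theorem cfc_walsh (T S : Finset (Fin n)) :
    cubeFourierCoeff (walsh T : (Fin n → Bool) → ℝ) S = if T = S then 1 else 0 := by
  unfold Literature.Computability.Complexity.LowDegree.cubeFourierCoeff
  rw [sum_walsh_mul_walsh_index]
  split_ifs
  · exact div_self (pow_ne_zero _ two_ne_zero)
  · simp

/-- **The moment functional** of a vector `z ∈ ℝ^{Idx}`: `Ẽ_z f = Σ_{|S| ≤ d} f̂(S) z_S` — the linear
functional on all real functions on the cube whose values on the characters `χ_S`, `|S| ≤ d`, are the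
coordinates `z_S` and which vanishes on the characters of degree `> d` ("we can extend it linearly to
all of `L²({−1,1}ⁿ)` by setting `Ẽ f = 0` for all functions `f` orthogonal to the space of degree-`d`
multilinear polynomials"). [cite: ChanEtAl2016, §2.1 (arXiv v3 p. 8)] -/
def momE (z : Idx n d → ℝ) : ((Fin n → Bool) → ℝ) →ₗ[ℝ] ℝ where
  toFun f := ∑ S : Idx n d, cubeFourierCoeff f S.1 * z S
  map_add' f g := by
    rw [← sum_add_distrib]
    refine sum_congr rfl fun S _ => ?_
    rw [cfc_add, add_mul]
  map_smul' a f := by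
    simp only [RingHom.id_apply, smul_eq_mul, mul_sum]
    refine sum_congr rfl fun S _ => ?_
    rw [cfc_smul, mul_assoc]

/-- Unfolding `momE`. [cite: ChanEtAl2016, §2.1 (arXiv v3 p. 8)] -/
theorem momE_apply (z : Idx n d → ℝ) (f : (Fin n → Bool) → ℝ) :
    momE z f = ∑ S : Idx n d, cubeFourierCoeff f S.1 * z S := rfl

/-- `Ẽ_z χ_S = z_S` for `|S| ≤ d` ("`Ẽ = Σ_{|α| ≤ d} (Ẽ χ_α) χ_α`").
[cite: ChanEtAl2016, §2.1 (arXiv v3 p. 8)] -/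
theorem momE_walsh (z : Idx n d → ℝ) (T : Idx n d) : momE z (walsh T.1) = z T := by
  rw [momE_apply]
  have : ∀ S : Idx n d, cubeFourierCoeff (walsh T.1 : (Fin n → Bool) → ℝ) S.1 * z S =
      if T = S then z S else 0 := by
    intro S
    rw [cfc_walsh]
    by_cases h : T = S
    · subst h; simp
    · have h' : T.1 ≠ S.1 := fun h' => h (Subtype.ext h')
      rw [if_neg h', if_neg h, zero_mul]
  simp_rw [this]
  rw [Finset.sum_ite_eq]
  simp

/-- `Ẽ_z 1 = z_∅`. [cite: ChanEtAl2016, §2.1 (arXiv v3 p. 8)] -/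
theorem momE_one (z : Idx n d → ℝ) : momE z (fun _ => 1) = z (idx0 n d) := by
  have : (fun _ : Fin n → Bool => (1 : ℝ)) = walsh (idx0 n d).1 := by
    funext x; simp [idx0]
  rw [this, momE_walsh]

/-- **The linearization vectors `v_x = (χ_S(x))_{|S| ≤ d}`** (the moments of the point mass at `x`).
[cite: ChanEtAl2016, §2.1 (arXiv v3 p. 8)] -/
def momV (x : Fin n → Bool) : Idx n d → ℝ := fun S => walsh S.1 x

/-- The moment functional of `v_x` is evaluation of the degree-`≤ d` truncation at `x`:
`Ẽ_{v_x} f = f_{≤ d}(x)`. [cite: ChanEtAl2016, §2.1 (arXiv v3 p. 8)] -/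
theorem momE_momV (x : Fin n → Bool) (f : (Fin n → Bool) → ℝ) :
    momE (momV (d := d) x) f = fourierTruncate d f x := by
  rw [momE_apply]
  unfold fourierTruncate
  simp only [momV]
  exact (Finset.sum_subtype (univ.filter fun S : Finset (Fin n) => S.card ≤ d) (by simp)
    (fun S => cubeFourierCoeff f S * walsh S x)).symm

/-! ### The inequalities: generator rows and normalisation -/

/-- Row indices of the LP: a generator row for every pair `(S, T)` of sets of size `≤ d`, and two
normalisation rows. [cite: ChanEtAl2016, §2.1 with eq. (2.3) (arXiv v3 p. 8)] -/
abbrev Row (n d : ℕ) : Type := (Idx n d × Idx n d) ⊕ Bool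

/-- The Boolean pattern `𝟙_T` of a set `T`. [cite: ChanEtAl2016, eq. (1.2) (arXiv v3 p. 5)] -/
def pat (T : Idx n d) : Fin n → Bool := fun i => decide (i ∈ T.1)

/-- **The constraint matrix** in moment coordinates: row `(S,T)` is `−(𝟙[x|_S = 𝟙_T|_S])^(·)`
(so that `A z ≤ 0` reads `Ẽ_z 𝟙[x|_S = 𝟙_T|_S] ≥ 0`), rows `true/false` are `± e_∅`.
[cite: ChanEtAl2016, §2.1 with eq. (2.3) (arXiv v3 p. 8)] -/
def momA : Matrix (Row n d) (Idx n d) ℝ :=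
  Sum.elim (fun ST S => -cubeFourierCoeff (SADuality.gen (ST.1, pat ST.2)) S.1)
    (fun bb S => if S = idx0 n d then (if bb then 1 else -1) else 0)

/-- **The right-hand sides**: `0` for generator rows, `1`, `−1` for the normalisation rows
(`z_∅ ≤ 1`, `−z_∅ ≤ −1`). [cite: ChanEtAl2016, §2.1 with eq. (2.3) (arXiv v3 p. 8)] -/
def momB : Row n d → ℝ := Sum.elim (fun _ => 0) (fun bb => if bb then 1 else -1)

/-- Generator rows of `A z`. [cite: ChanEtAl2016, §2.1 with eq. (2.3) (arXiv v3 p. 8)] -/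
theorem mulVec_momA_inl (z : Idx n d → ℝ) (ST : Idx n d × Idx n d) :
    (momA *ᵥ z) (Sum.inl ST) = -momE z (SADuality.gen (ST.1, pat ST.2)) := by
  rw [momE_apply]
  simp only [Matrix.mulVec, dotProduct, momA, Sum.elim_inl, neg_mul, sum_neg_distrib]

/-- Normalisation rows of `A z`. [cite: ChanEtAl2016, §2.1 with eq. (2.3) (arXiv v3 p. 8)] -/
theorem mulVec_momA_inr (z : Idx n d → ℝ) (bb : Bool) :
    (momA *ᵥ z) (Sum.inr bb) = if bb then z (idx0 n d) else -z (idx0 n d) := by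
  simp only [Matrix.mulVec, dotProduct, momA, Sum.elim_inr]
  simp_rw [ite_mul, zero_mul]
  rw [Finset.sum_ite_eq']
  cases bb <;> simp

/-- Feasibility of a moment vector: `A z ≤ b`. [cite: ChanEtAl2016, §2.1 with eq. (2.3) (arXiv v3 p. 8)] -/
def Feasible (z : Idx n d → ℝ) : Prop := ∀ r, (momA *ᵥ z) r ≤ momB r

/-- A feasible `z` is nonnegative on the generators `𝟙[x|_S = 𝟙_T|_S]`.
[cite: ChanEtAl2016, §2.1 with eq. (2.3) (arXiv v3 p. 8)] -/
theorem Feasible.gen_nonneg {z : Idx n d → ℝ} (hz : Feasible z) (S T : Idx n d) :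
    0 ≤ momE z (SADuality.gen (S, pat T)) := by
  have h := hz (Sum.inl (S, T))
  rw [mulVec_momA_inl] at h
  simp only [momB, Sum.elim_inl, neg_nonpos] at h
  exact h

/-- A feasible `z` has `z_∅ = 1`. [cite: ChanEtAl2016, §2.1 with eq. (2.3) (arXiv v3 p. 8)] -/
theorem Feasible.idx0_eq_one {z : Idx n d → ℝ} (hz : Feasible z) : z (idx0 n d) = 1 := by
  have h1 := hz (Sum.inr true)
  have h2 := hz (Sum.inr false)
  rw [mulVec_momA_inr] at h1 h2
  simp only [momB, Sum.elim_inr, if_true] at h1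
  simp only [momB, Sum.elim_inr, Bool.false_eq_true, if_false, neg_le_neg_iff] at h2
  exact le_antisymm h1 h2

/-- **A feasible moment vector is a degree-`d` Sherali–Adams pseudoexpectation** (via its moment
functional): nonnegativity on ALL nonnegative `d`-juntas follows from the generator rows by
Lemma 2.4(i) (`junta_decomp`: a nonnegative junta on `S` is `Σ_β p(β) 𝟙[x|_S = β|_S]` over the
patterns `β` vanishing off `S`, and such a `β` is `𝟙_T`, `T = supp β ⊆ S`), and `Ẽ_z 1 = z_∅ = 1`.
[cite: ChanEtAl2016, Lemma 2.4 (i) and eq. (2.3) (arXiv v3 p. 8)] -/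
def toPE (z : Idx n d → ℝ) (hz : Feasible z) : SAPseudoexpectation n d where
  E := momE z
  nonneg := by
    classical
    intro p hp hp0
    obtain ⟨S, hS, hdep⟩ := hp
    have hdec : p = ∑ β : Fin n → Bool,
        (if ∀ i ∉ S, β i = false then p β else 0) • SADuality.gen (⟨S, hS⟩, β) := by
      funext x
      rw [SADuality.junta_decomp hS hdep x]
      simp only [Finset.sum_apply, Pi.smul_apply, smul_eq_mul]
    rw [hdec, map_sum]
    refine sum_nonneg fun β _ => ?_
    rw [map_smul, smul_eq_mul]
    by_cases hβ : ∀ i ∉ S, β i = false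
    · rw [if_pos hβ]
      refine mul_nonneg (hp0 β) ?_
      obtain ⟨T, hT⟩ : ∃ T : Finset (Fin n), T = univ.filter fun i => β i = true := ⟨_, rfl⟩
      have hTS : T ⊆ S := by
        intro i hi
        by_contra hiS
        have hf := hβ i hiS
        rw [hT, mem_filter] at hi
        rw [hf] at hi
        exact Bool.false_ne_true hi.2
      have hTd : T.card ≤ d := (card_le_card hTS).trans hS
      have hpat : β = pat ⟨T, hTd⟩ := by
        funext i
        simp [pat, hT]
      rw [hpat]
      exact hz.gen_nonneg ⟨S, hS⟩ ⟨T, hTd⟩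
    · rw [if_neg hβ, zero_mul]
  map_one := by rw [momE_one, hz.idx0_eq_one]

/-- Unfolding `toPE`. [cite: ChanEtAl2016, §2.1 (arXiv v3 p. 8)] -/
@[simp] theorem toPE_E (z : Idx n d → ℝ) (hz : Feasible z) : (toPE z hz).E = momE z := rfl

/-- **Boundedness**: a feasible moment vector has all coordinates in `[−1, 1]`
(`|z_S| = |Ẽ_z χ_S| ≤ 1`, Lemma 2.4(ii)). [cite: ChanEtAl2016, Lemma 2.4 (ii) (arXiv v3 p. 8)] -/
theorem Feasible.abs_le_one {z : Idx n d → ℝ} (hz : Feasible z) (S : Idx n d) : |z S| ≤ 1 := by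
  have h := (toPE z hz).abs_E_walsh_le_one S.2
  rwa [toPE_E, momE_walsh] at h

/-- **The true moment vectors are feasible**: `Ẽ_{v_x} g = g_{≤ d}(x) = g(x) ≥ 0` for every generator
`g` (a `d`-junta, hence of degree `≤ d`), and `(v_x)_∅ = χ_∅(x) = 1`.
[cite: ChanEtAl2016, §2.1 (arXiv v3 p. 8)] -/
theorem feasible_momV (x : Fin n → Bool) : Feasible (momV (d := d) x) := by
  intro r
  rcases r with ⟨S, T⟩ | bb
  · rw [mulVec_momA_inl, momE_momV,
      fourierTruncate_eq_self_of_hasDegreeLE (SADuality.isJunta_gen _).hasDegreeLE]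
    simp only [momB, Sum.elim_inl, neg_nonpos]
    exact SADuality.gen_nonneg _ _
  · rw [mulVec_momA_inr]
    have h0 : momV (d := d) x (idx0 n d) = 1 := by simp [momV, idx0]
    cases bb <;> simp [momB, h0]

/-- **The moment functional of a feasible vector is bounded by `c` on instances of value `≤ s`**
whenever `SA_d` achieves `(c,s)`. [cite: ChanEtAl2016, §2.1 (arXiv v3 p. 8)] -/
theorem Feasible.momE_val_le {k : ℕ} {P : Set ((Fin k → Bool) → Bool)} {c s : ℝ}
    (hSA : SAAchieves (n := n) P d c s) (I : CSPInstance k n P) (hI : I.OptLE s)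
    {z : Idx n d → ℝ} (hz : Feasible z) : momE z I.val ≤ c :=
  hSA I hI (toPE z hz)

/-- **The moment vector `(Ẽ χ_S)_{|S| ≤ d}` of a pseudoexpectation** ("`Ẽ` is only an
`n^d`-dimensional object"). [cite: ChanEtAl2016, §2.1 (arXiv v3 p. 8)] -/
def ofPE (pE : SAPseudoexpectation n d) : Idx n d → ℝ := fun S => pE.E (walsh S.1)

/-- The moment functional of the moment vector of `Ẽ` is `Ẽ ∘ (·)_{≤ d}` (`= Ẽ` on degree `≤ d`).
[cite: ChanEtAl2016, §2.1 (arXiv v3 p. 8)] -/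
theorem momE_ofPE (pE : SAPseudoexpectation n d) (f : (Fin n → Bool) → ℝ) :
    momE (ofPE pE) f = pE.truncate.E f := by
  rw [momE_apply, pE.truncate_E_eq_sum]
  simp only [ofPE]
  exact (Finset.sum_subtype (univ.filter fun S : Finset (Fin n) => S.card ≤ d) (by simp)
    (fun S => cubeFourierCoeff f S * pE.E (walsh S))).symm

/-- **Every degree-`d` pseudoexpectation gives a feasible moment vector** — with `toPE`, the feasible
region of the LP is exactly the set of (moment vectors of) degree-`d` pseudoexpectations.
[cite: ChanEtAl2016, §2.1 with eq. (2.3) (arXiv v3 p. 8)] -/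
theorem feasible_ofPE (pE : SAPseudoexpectation n d) : Feasible (ofPE pE) := by
  intro r
  rcases r with ⟨S, T⟩ | bb
  · rw [mulVec_momA_inl, momE_ofPE,
      pE.truncate_E_of_hasDegreeLE (SADuality.isJunta_gen _).hasDegreeLE]
    simp only [momB, Sum.elim_inl, neg_nonpos]
    exact pE.nonneg _ (SADuality.isJunta_gen _) (SADuality.gen_nonneg _)
  · rw [mulVec_momA_inr]
    have h0 : ofPE pE (idx0 n d) = 1 := by
      simp only [ofPE, idx0]
      have h1 : (walsh (∅ : Finset (Fin n)) : (Fin n → Bool) → ℝ) = fun _ => 1 := by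
        funext x; simp
      rw [h1, pE.map_one]
    cases bb <;> simp [momB, h0]

/-! ### Sizes -/

/-- The dimension `D = #{S ⊆ [n] : |S| ≤ d}` of the linearization.
[cite: ChanEtAl2016, §2.1 (arXiv v3 p. 8: "Ẽ is only an n^d-dimensional object")] -/
def dim (n d : ℕ) : ℕ := Fintype.card (Idx n d)

/-- The number of inequalities `R = D² + 2`. [cite: ChanEtAl2016, §2.1 (arXiv v3 p. 8: "n^{O(d)}-sized")] -/
def size (n d : ℕ) : ℕ := Fintype.card (Row n d)

/-- `D = Σ_{i ≤ d} C(n, i)`. [cite: ChanEtAl2016, §2.1 (arXiv v3 p. 8)] -/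
theorem dim_eq : dim n d = ∑ i ∈ range (d + 1), n.choose i := by
  rw [dim, Fintype.card_subtype, card_filter_card_le]

/-- `D ≤ 1 + n^d`. [cite: ChanEtAl2016, §2.1 (arXiv v3 p. 8)] -/
theorem dim_le : dim n d ≤ 1 + n ^ d := by
  rw [dim_eq]; exact sum_range_choose_le_one_add_pow n d

/-- `R = D² + 2`. [cite: ChanEtAl2016, §2.1 (arXiv v3 p. 8)] -/
theorem size_eq : size n d = dim n d ^ 2 + 2 := by
  simp [size, dim, Fintype.card_sum, Fintype.card_prod, sq]

/-- `R ≤ (1 + n^d)² + 2 = n^{O(d)}`. [cite: ChanEtAl2016, §2.1 (arXiv v3 p. 8)] -/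
theorem size_le : size n d ≤ (1 + n ^ d) ^ 2 + 2 := by
  rw [size_eq]
  exact Nat.add_le_add_right (Nat.pow_le_pow_left dim_le 2) 2

/-! ### The LP relaxation (reindexed by `Fin`) -/

/-- Enumeration of the moment indices. [folklore] -/
def eI (n d : ℕ) : Idx n d ≃ Fin (dim n d) := Fintype.equivFin _

/-- Enumeration of the rows. [folklore] -/
def eR (n d : ℕ) : Row n d ≃ Fin (size n d) := Fintype.equivFin _

/-- The constraint matrix, reindexed by `Fin`. [cite: ChanEtAl2016, §2.1 with eq. (2.3) (arXiv v3 p. 8)] -/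
def finA (n d : ℕ) : Matrix (Fin (size n d)) (Fin (dim n d)) ℝ :=
  Matrix.of fun i j => momA ((eR n d).symm i) ((eI n d).symm j)

/-- The right-hand sides, reindexed by `Fin`. [cite: ChanEtAl2016, §2.1 with eq. (2.3) (arXiv v3 p. 8)] -/
def finB (n d : ℕ) : Fin (size n d) → ℝ := fun i => momB ((eR n d).symm i)

/-- Reindexing a dot product along an enumeration. [folklore] -/
private theorem dot_reindex {ι : Type*} [Fintype ι] {D : ℕ} (e : ι ≃ Fin D) (w : ι → ℝ)
    (y : Fin D → ℝ) : (fun j => w (e.symm j)) ⬝ᵥ y = ∑ S, w S * y (e S) := by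
  simp only [dotProduct]
  exact Fintype.sum_equiv e.symm _ _ fun j => by simp

/-- Reindexing a matrix–vector product along enumerations. [folklore] -/
private theorem mulVec_reindex {ρ ι : Type*} [Fintype ρ] [Fintype ι] {R D : ℕ} (eρ : ρ ≃ Fin R)
    (eι : ι ≃ Fin D) (M : Matrix ρ ι ℝ) (y : Fin D → ℝ) (i : Fin R) :
    (Matrix.of (fun i j => M (eρ.symm i) (eι.symm j)) *ᵥ y) i = (M *ᵥ fun S => y (eι S)) (eρ.symm i) := by
  simp only [Matrix.mulVec, Matrix.of_apply, dotProduct]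
  exact Fintype.sum_equiv eι.symm _ _ fun j => by simp

/-- A point of the reindexed polytope is a feasible moment vector. [cite: ChanEtAl2016, §2.1 with eq. (2.3) (arXiv v3 p. 8)] -/
theorem feasible_of_mem {y : Fin (dim n d) → ℝ} (hy : ∀ i, (finA n d *ᵥ y) i ≤ finB n d i) :
    Feasible fun S => y (eI n d S) := by
  intro r
  have h := hy (eR n d r)
  rw [finA, mulVec_reindex] at h
  simpa [finB] using h

variable {k : ℕ}

/-- **The `d`-round Sherali–Adams LP relaxation of Max-`𝒫` on `n` variables as an `LPRelaxation` of
size `R = (Σ_{i ≤ d} C(n,i))² + 2`** (for `k ≤ d`, the range in which `SA_d` is defined): linearization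
`v_x = (χ_S(x))_{|S| ≤ d}`, `w_ℑ = (ℑ̂(S))_{|S| ≤ d}` (exact by Fourier inversion, `deg ℑ ≤ k ≤ d`),
polytope `{y : Ẽ_y 𝟙[x|_S = 𝟙_T|_S] ≥ 0 (|S|,|T| ≤ d), y_∅ = 1}` — bounded since it lies in `[−1,1]^D`.
[cite: ChanEtAl2016, §2.1 (arXiv v3 p. 8: "This optimization problem can be implemented by an n^{O(d)}-sized linear programming relaxation")] -/
def relaxation (k n d : ℕ) (P : Set ((Fin k → Bool) → Bool)) (hkd : k ≤ d) :
    LPRelaxation k n P (size n d) where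
  D := dim n d
  v x j := momV x ((eI n d).symm j)
  w I j := cubeFourierCoeff I.val ((eI n d).symm j).1
  exact I x := by
    rw [dot_reindex (eI n d) (fun S : Idx n d => cubeFourierCoeff I.val S.1)]
    have h : ∑ S : Idx n d, cubeFourierCoeff I.val S.1 * momV x ((eI n d).symm (eI n d S)) =
        momE (momV (d := d) x) I.val := by
      rw [momE_apply]
      simp only [Equiv.symm_apply_apply]
    rw [h, momE_momV, fourierTruncate_eq_self_of_hasDegreeLE (I.hasDegreeLE_val.mono hkd)]
  A := finA n d
  b := finB n d
  mem x i := by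
    rw [finA, mulVec_reindex]
    simp only [Equiv.symm_apply_apply, finB]
    exact feasible_momV x _
  bounded := by
    rw [isBounded_iff_forall_norm_le]
    refine ⟨1, fun y hy => ?_⟩
    rw [pi_norm_le_iff_of_nonneg zero_le_one]
    intro j
    have hz : Feasible fun S => y (eI n d S) := feasible_of_mem hy
    have h := hz.abs_le_one ((eI n d).symm j)
    simp only [Equiv.apply_symm_apply] at h
    rw [Real.norm_eq_abs]
    exact h

/-- A feasible moment vector, reindexed, is a point of the polytope. [cite: ChanEtAl2016, §2.1 with eq. (2.3) (arXiv v3 p. 8)] -/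
theorem mem_of_feasible {z : Idx n d → ℝ} (hz : Feasible z) (i : Fin (size n d)) :
    (finA n d *ᵥ fun j => z ((eI n d).symm j)) i ≤ finB n d i := by
  rw [finA, mulVec_reindex]
  simp only [Equiv.symm_apply_apply, finB]
  exact hz _

/-- The objective of the LP at a reindexed moment vector is the moment functional of the instance.
[cite: ChanEtAl2016, §2.1 (arXiv v3 p. 8)] -/
theorem relaxation_w_dotProduct {P : Set ((Fin k → Bool) → Bool)} (hkd : k ≤ d)
    (I : CSPInstance k n P) (y : Fin (dim n d) → ℝ) :
    (relaxation k n d P hkd).w I ⬝ᵥ y = momE (fun S => y (eI n d S)) I.val := by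
  rw [momE_apply]
  exact dot_reindex (eI n d) (fun S : Idx n d => cubeFourierCoeff I.val S.1) y

/-- **The LP computes the Sherali–Adams value exactly**: for every instance `ℑ` (`k ≤ d`) and `c`,
`opt_𝒫(ℑ) ≤ c` for the LP relaxation `SALp.relaxation` if and only if `SA_d(ℑ) ≤ c`, i.e. `Ẽ ℑ ≤ c`
for every degree-`d` pseudoexpectation ("This optimization problem can be implemented by an
`n^{O(d)}`-sized linear programming relaxation"). [cite: ChanEtAl2016, §2.1 (arXiv v3 p. 8)] -/
theorem relaxation_valueLE_iff {P : Set ((Fin k → Bool) → Bool)} (hkd : k ≤ d)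
    (I : CSPInstance k n P) (c : ℝ) :
    (relaxation k n d P hkd).ValueLE I c ↔ ∀ pE : SAPseudoexpectation n d, pE.E I.val ≤ c := by
  constructor
  · intro h pE
    have hv := h _ (mem_of_feasible (feasible_ofPE pE))
    rw [relaxation_w_dotProduct] at hv
    simp only [Equiv.symm_apply_apply] at hv
    rwa [momE_ofPE, pE.truncate_E_of_hasDegreeLE (I.hasDegreeLE_val.mono hkd)] at hv
  · intro h y hy
    rw [relaxation_w_dotProduct]
    exact h (toPE _ (feasible_of_mem hy))

/-- **The Sherali–Adams LP achieves exactly what `SA_d` achieves**: for `k ≤ d` and every `c, s`,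
`SALp.relaxation` achieves a `(c,s)`-approximation on `n`-variable instances of Max-`𝒫` if and only
if the `d`-round Sherali–Adams relaxation does. [cite: ChanEtAl2016, §2.1 (arXiv v3 p. 8)] -/
theorem relaxation_achieves_iff {P : Set ((Fin k → Bool) → Bool)} (hkd : k ≤ d) {c s : ℝ} :
    (relaxation k n d P hkd).Achieves c s ↔ SAAchieves (n := n) P d c s :=
  forall_congr' fun I => imp_congr_right fun _ => relaxation_valueLE_iff hkd I c

/-- **The Sherali–Adams LP achieves what `SA_d` achieves** (the direction printed: "if `d`-rounds of
Sherali–Adams achieve a `(c,s)`-approximation for `Π_n`, then so do general `n^{O(d)}`-sized LP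
relaxations"). [cite: ChanEtAl2016, §2.1 (arXiv v3 p. 8)] -/
theorem relaxation_achieves {P : Set ((Fin k → Bool) → Bool)} (hkd : k ≤ d) {c s : ℝ}
    (hSA : SAAchieves (n := n) P d c s) : (relaxation k n d P hkd).Achieves c s :=
  (relaxation_achieves_iff hkd).2 hSA

end SALp

/-! ### Headline statements -/

/-- **Chan–Lee–Raghavendra–Steurer §2.1: `SA_d` IS an LP relaxation of size `n^{O(d)}` — PROVED.**
For a `k`-ary Max-CSP `𝒫` and `k ≤ d` there is ONE LP relaxation of Max-`𝒫` on `n` variables (in the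
sense of `LPRelaxation`: linearization + bounded polytope containing all `v_x`), of size
`R ≤ (1 + n^d)² + 2`, which for every `c, s` achieves a `(c,s)`-approximation exactly when the
`d`-round Sherali–Adams relaxation does ("`SA_d(ℑ) = max_{Ẽ} Ẽ ℑ` … can be implemented by an
`n^{O(d)}`-sized linear programming relaxation for `Π_n`").
[cite: ChanEtAl2016, §2.1 (arXiv v3 p. 8)] -/
theorem ChanEtAl2016_sa_as_lp {k n d : ℕ} {P : Set ((Fin k → Bool) → Bool)} (hkd : k ≤ d) :
    ∃ R : ℕ, R ≤ (1 + n ^ d) ^ 2 + 2 ∧ ∃ L : LPRelaxation k n P R,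
      ∀ c s : ℝ, L.Achieves c s ↔ SAAchieves (n := n) P d c s :=
  ⟨SALp.size n d, SALp.size_le, SALp.relaxation k n d P hkd, fun _ _ => SALp.relaxation_achieves_iff hkd⟩

/-- **Chan–Lee–Raghavendra–Steurer §2.1: `d` rounds of Sherali–Adams are implemented by an LP
relaxation of size `n^{O(d)}` — PROVED.**  For a `k`-ary Max-CSP `𝒫`, `k ≤ d`, and reals `c, s`: if
the `d`-round Sherali–Adams relaxation achieves a `(c,s)`-approximation on `n`-variable instances,
then some LP relaxation (in the sense of `LPRelaxation`: linearization + bounded polytope containing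
all `v_x`) of size `R ≤ (1 + n^d)² + 2` achieves a `(c,s)`-approximation on `n`-variable instances.
("In particular, if `d`-rounds of Sherali–Adams achieve a `(c,s)`-approximation for `Π_n`, then so do
general `n^{O(d)}`-sized LP relaxations.")  Converse companion of `ChanEtAl2016_thm31_holds`.
[cite: ChanEtAl2016, §2.1 (arXiv v3 p. 8)] -/
theorem ChanEtAl2016_lp_of_saAchieves {k n d : ℕ} {P : Set ((Fin k → Bool) → Bool)} {c s : ℝ}
    (hkd : k ≤ d) (hSA : SAAchieves (n := n) P d c s) :
    ∃ R : ℕ, R ≤ (1 + n ^ d) ^ 2 + 2 ∧ ∃ L : LPRelaxation k n P R, L.Achieves c s :=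
  ⟨SALp.size n d, SALp.size_le, SALp.relaxation k n d P hkd, SALp.relaxation_achieves hkd hSA⟩

/-- **Contrapositive, in the shape of Theorem 3.1**: if no LP relaxation of size `≤ (1 + n^d)² + 2`
achieves a `(c,s)`-approximation on `n`-variable instances of Max-`𝒫` (`k ≤ d`), then `d` rounds of
Sherali–Adams do not achieve it either. [cite: ChanEtAl2016, §2.1 (arXiv v3 p. 8)] -/
theorem ChanEtAl2016_not_saAchieves_of_lp {k n d : ℕ} {P : Set ((Fin k → Bool) → Bool)} {c s : ℝ}
    (hkd : k ≤ d)
    (h : ∀ R : ℕ, R ≤ (1 + n ^ d) ^ 2 + 2 → ∀ L : LPRelaxation k n P R, ¬ L.Achieves c s) :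
    ¬ SAAchieves (n := n) P d c s := by
  intro hSA
  obtain ⟨R, hR, L, hL⟩ := ChanEtAl2016_lp_of_saAchieves hkd hSA
  exact h R hR L hL

end Literature.Combinatorics.Optimization
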